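import Summits.AtomisticToContinuum.BoseEinsteinCondensation.Theorems.BoxCountShadowC
import HarnessLib

/-!
# BoxCountShadowCell — continuation of BoxCountShadow(C): the second carving NUM_h ⟺ MARG_h ∧ CSUF_h (§6)

Continuation of `BoxCountShadow` / `BoxCountShadowB` / `BoxCountShadowC` (same namespace).  Data processing along
`m ↦ m_B` (`fibreAffinity_mono_coarse`) gives `countAffinity ≤ cellCountAffinity ≤ 1`; pieces
`GroundStateHorizonCellCountAffinity` (MARG_h, declared residual of gen 35 v2: unit-scale smoothness of ONE horizon
cell's occupation-number law) and `GroundStateHorizonCellCountSufficiency` (CSUF_h); exact carving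
`horizonCountAffinity_iff_cell`, composed `horizonLabelAffinity_iff_cell`, deciding kernel `bec_of_cellCountPieces₀`.
No instances, no notation, no sorry.
-/

open MeasureTheory Filter Set
open scoped ENNReal NNReal BigOperators

namespace Summit.AtomisticToContinuum.BoseEinsteinCondensation.Theorems.BoxCountShadow

open Literature.MathematicalPhysics.QuantumManyBody.BoseGas
open Summit.AtomisticToContinuum.BoseEinsteinCondensation.Theorems.BoxLatticeFSum
open Summit.AtomisticToContinuum.BoseEinsteinCondensation.Theorems.BoxLabelAffinity
open Summit.AtomisticToContinuum.BoseEinsteinCondensation.Theorems.BoxHorizonAffinity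

variable {n : ℕ}

/-! ### §6  Second carving — the ONE-CELL count shadow: NUM_h ⟺ MARG_h ∧ CSUF_h

Project the count field `m(Y) ∈ ℕ^{K³}` further onto ONE coordinate `m_B(Y) ∈ ℕ`, the occupation number of a
single horizon cell.  Data processing along `m ↦ m_B` (abstractly: the fibrewise Bhattacharyya sum is monotone
under coarsening of the statistic, `fibreAffinity_mono_coarse`) gives `countAffinity ≤ cellCountAffinity ≤ 1`
with `cellCountAffinity = Σ_B K^{-3/2} Σ_j P̄_B(j)^{1/2} Q_B(j)^{1/2}`, `P̄_B(j) = ∫_{m_B = j} P̂`,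
`Q_B(j) = ∫_{m_B = j} q_B`: cell by cell, the affinity between the law of the cell's occupation number among the
other particles and its law given that the inserted particle lies in that cell — for a symmetric state, the law of
`N_B` against its SIZE-BIASED SHIFT `j ↦ (j+1) p_B(j+1) / E N_B` (equal iff Poisson: the Stein–Chen identity;
affinity `1 − O(1/Var + Var/mean²)` for any unit-scale-smooth law).  Hence the exact second carving
NUM_h ⟺ MARG_h ∧ CSUF_h: MARG_h = ONE-CELL insertion tolerance, a statement about one integer-valued random
variable per cell; CSUF_h = cell-count sufficiency, `countAffinity ≥ s · cellCountAffinity`. -/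

section AbstractCoarse

variable {β : Type*} [MeasurableSpace β] {σ : Type*} [MeasurableSpace σ] [MeasurableSingletonClass σ]
  [Countable σ] {τ : Type*} [MeasurableSpace τ] [MeasurableSingletonClass τ] [Countable τ]

omit [Countable τ] in
/-- Fibres of a coarsened statistic: `Σ'_{m : π m = j} ∫_{T = m} g = ∫_{π ∘ T = j} g`, the left side written as
a set integral against the counting measure. [folklore] -/
theorem setLIntegral_count_fibre (ν : Measure β) {T : β → σ} (hT : Measurable T) (π : σ → τ)
    (g : β → ℝ≥0∞) (j : τ) :
    ∫⁻ m in π ⁻¹' {j}, (∫⁻ b in T ⁻¹' {m}, g b ∂ν) ∂Measure.count = ∫⁻ b in (π ∘ T) ⁻¹' {j}, g b ∂ν := by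
  have hπ : MeasurableSet (π ⁻¹' ({j} : Set τ)) := (measurable_of_countable π) (measurableSet_singleton j)
  rw [← lintegral_indicator (μ := (Measure.count : Measure σ)) hπ, lintegral_count,
    lintegral_eq_tsum_fibre (ν.restrict ((π ∘ T) ⁻¹' {j})) hT g]
  refine tsum_congr fun m => ?_
  rw [Measure.restrict_restrict (hT (measurableSet_singleton m))]
  by_cases hm : π m = j
  · have hmem : m ∈ π ⁻¹' ({j} : Set τ) := hm
    have hsub : T ⁻¹' ({m} : Set σ) ⊆ (π ∘ T) ⁻¹' {j} := fun b hb => by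
      simp only [Set.mem_preimage, Set.mem_singleton_iff, Function.comp_apply] at hb ⊢
      rw [hb, hm]
    rw [Set.indicator_of_mem hmem, Set.inter_eq_left.2 hsub]
  · have hnmem : m ∉ π ⁻¹' ({j} : Set τ) := hm
    have hempty : T ⁻¹' ({m} : Set σ) ∩ (π ∘ T) ⁻¹' {j} = ∅ := by
      ext b
      simp only [Set.mem_inter_iff, Set.mem_preimage, Set.mem_singleton_iff, Function.comp_apply,
        Set.mem_empty_iff_false, iff_false, not_and]
      intro hb
      rw [hb]
      exact hm
    rw [Set.indicator_of_notMem hnmem, hempty, Measure.restrict_empty, lintegral_zero_measure]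

/-- **Coarse-graining monotonicity of the fibre affinity** (data processing for the Bhattacharyya coefficient
along `π`): the fibrewise sum over the fibres of `T` is at most the one over the coarser fibres of `π ∘ T`.
[folklore] -/
theorem fibreAffinity_mono_coarse (ν : Measure β) {T : β → σ} (hT : Measurable T) (π : σ → τ)
    (g q : β → ℝ≥0∞) :
    ∑' m, (∫⁻ b in T ⁻¹' {m}, g b ∂ν) ^ (1 / 2 : ℝ) * (∫⁻ b in T ⁻¹' {m}, q b ∂ν) ^ (1 / 2 : ℝ) ≤
      ∑' j, (∫⁻ b in (π ∘ T) ⁻¹' {j}, g b ∂ν) ^ (1 / 2 : ℝ) *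
        (∫⁻ b in (π ∘ T) ⁻¹' {j}, q b ∂ν) ^ (1 / 2 : ℝ) := by
  have sq_rpow_half : ∀ m : ℝ≥0∞, (m ^ (1 / 2 : ℝ)) ^ 2 = m := fun m => by
    rw [← ENNReal.rpow_two, ← ENNReal.rpow_mul]; norm_num
  have h := shadow_core (Measure.count : Measure σ) (T := π) (measurable_of_countable π)
    (a₁ := fun m => (∫⁻ b in T ⁻¹' {m}, g b ∂ν) ^ (1 / 2 : ℝ))
    (a₂ := fun m => (∫⁻ b in T ⁻¹' {m}, q b ∂ν) ^ (1 / 2 : ℝ))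
    (q₁ := fun m => ∫⁻ b in T ⁻¹' {m}, g b ∂ν) (q₂ := fun m => ∫⁻ b in T ⁻¹' {m}, q b ∂ν)
    (measurable_of_countable _) (measurable_of_countable _) (fun m => (sq_rpow_half _).le)
    (fun m => (sq_rpow_half _).le)
  rw [lintegral_count] at h
  refine h.trans (le_of_eq (tsum_congr fun j => ?_))
  rw [setLIntegral_count_fibre ν hT π g j, setLIntegral_count_fibre ν hT π q j]

end AbstractCoarse

/-- `P̄_B(j) = ∫_{m_B(Y) = j} P̂(Y) dY`: the law of the occupation number of cell `B` among the other particles.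
[folklore] -/
noncomputable def cellSlice (L : ℝ) (K : ℕ) (Φ : Config (n + 1) → ℝ) (B : SubIdx K) (j : ℕ) : ℝ≥0∞ :=
  ∫⁻ Y in ((fun m : SubIdx K → ℕ => m B) ∘ countVec (L / (K : ℝ)) K) ⁻¹' {j}, sliceSq Φ Y

/-- `Q_B(j) = ∫_{m_B(Y) = j} q_B(Y) dY` (`= (j+1) p_B(j+1)/N` for a symmetric state, `p_B` = law of `N_B`): the
joint weight of «particle 1 in cell `B`, the others have `j` particles in `B`». [folklore] -/
noncomputable def cellMass (L : ℝ) (K : ℕ) (Φ : Config (n + 1) → ℝ) (B : SubIdx K) (j : ℕ) : ℝ≥0∞ :=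
  ∫⁻ Y in ((fun m : SubIdx K → ℕ => m B) ∘ countVec (L / (K : ℝ)) K) ⁻¹' {j}, blockMass L K Φ B Y

/-- **One-cell count affinity** `Σ_B K^{-3/2} Σ_j P̄_B(j)^{1/2} Q_B(j)^{1/2}`: insertion affinity seen through ONE
cell's occupation number at a time.  NEW OBJECT of §6. [folklore] -/
noncomputable def cellCountAffinity (L : ℝ) (K : ℕ) (Φ : Config (n + 1) → ℝ) : ℝ≥0∞ :=
  ∑ B : SubIdx K, blockWeight K *
    ∑' j : ℕ, cellSlice L K Φ B j ^ (1 / 2 : ℝ) * cellMass L K Φ B j ^ (1 / 2 : ℝ)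

/-- **NUM ≤ MARG functional**: `countAffinity ≤ cellCountAffinity` for every `Φ` (data processing along
`m ↦ m_B`, cell by cell). [folklore] -/
theorem countAffinity_le_cellCountAffinity (L : ℝ) (K : ℕ) (Φ : Config (n + 1) → ℝ) :
    countAffinity L K Φ ≤ cellCountAffinity L K Φ := by
  unfold countAffinity cellCountAffinity
  have hpt : ∀ m : SubIdx K → ℕ, fibreSlice L K Φ m ^ (1 / 2 : ℝ) *
      ∑ B : SubIdx K, blockWeight K * fibreMass L K Φ B m ^ (1 / 2 : ℝ) =
      ∑ B : SubIdx K, blockWeight K *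
        (fibreSlice L K Φ m ^ (1 / 2 : ℝ) * fibreMass L K Φ B m ^ (1 / 2 : ℝ)) := by
    intro m
    rw [Finset.mul_sum]
    exact Finset.sum_congr rfl fun B _ => by ring
  simp_rw [hpt]
  rw [Summable.tsum_finsetSum (fun _ _ => ENNReal.summable)]
  refine Finset.sum_le_sum fun B _ => ?_
  rw [ENNReal.tsum_mul_left]
  refine mul_le_mul' le_rfl ?_
  exact fibreAffinity_mono_coarse volume (measurable_countVec (L / (K : ℝ)) K)
    (fun m : SubIdx K → ℕ => m B) (sliceSq Φ) (blockMass L K Φ B)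

/-- **The one-cell count affinity is an affinity**: `cellCountAffinity ≤ 1` for a normalised amplitude
(Cauchy–Schwarz in `j`, then in `B`, then the blocks tile the cell). [folklore] -/
theorem cellCountAffinity_le_one {L : ℝ} {K : ℕ} (hL : 0 < L) (hK : 0 < K) {Φ : Config (n + 1) → ℝ}
    (hΦm : Measurable Φ) (hΦ1 : ∫⁻ Y : Config n, ∫⁻ x, ENNReal.ofReal (Φ (Matrix.vecCons x Y)) ^ 2 = 1) :
    cellCountAffinity L K Φ ≤ 1 := by
  have hT : ∀ B : SubIdx K,
      Measurable ((fun m : SubIdx K → ℕ => m B) ∘ countVec (n := n) (L / (K : ℝ)) K) :=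
    fun B => (measurable_pi_apply B).comp (measurable_countVec (L / (K : ℝ)) K)
  have hS : ∀ B : SubIdx K, ∑' j : ℕ, cellSlice L K Φ B j = 1 := by
    intro B
    unfold cellSlice
    rw [← lintegral_eq_tsum_fibre volume (hT B) (sliceSq Φ)]
    exact hΦ1
  have hM : ∀ B : SubIdx K, ∑' j : ℕ, cellMass L K Φ B j = ∫⁻ Y, blockMass L K Φ B Y := by
    intro B
    unfold cellMass
    rw [← lintegral_eq_tsum_fibre volume (hT B) (blockMass L K Φ B)]
  have hint : (∫⁻ Y : Config n, sliceSq Φ Y) = 1 := hΦ1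
  unfold cellCountAffinity
  calc ∑ B : SubIdx K, blockWeight K *
        ∑' j : ℕ, cellSlice L K Φ B j ^ (1 / 2 : ℝ) * cellMass L K Φ B j ^ (1 / 2 : ℝ)
      ≤ ∑ B : SubIdx K, blockWeight K * (∫⁻ Y, blockMass L K Φ B Y) ^ (1 / 2 : ℝ) := by
        refine Finset.sum_le_sum fun B _ => mul_le_mul' le_rfl ?_
        refine (tsum_rpow_half_mul_le _ _).trans ?_
        rw [hS B, ENNReal.one_rpow, one_mul, hM B]
    _ ≤ (∑ _B : SubIdx K, blockWeight K ^ 2) ^ (1 / 2 : ℝ) *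
          (∑ B : SubIdx K, ∫⁻ Y, blockMass L K Φ B Y) ^ (1 / 2 : ℝ) := sum_mul_rpow_half_le _ _ _
    _ ≤ 1 := by
        rw [sum_blockWeight_sq hK, ENNReal.one_rpow, one_mul,
          ← lintegral_finsetSum _ fun B _ => measurable_blockMass L K hΦm B]
        calc (∫⁻ Y, ∑ B : SubIdx K, blockMass L K Φ B Y) ^ (1 / 2 : ℝ)
            ≤ (∫⁻ Y : Config n, sliceSq Φ Y) ^ (1 / 2 : ℝ) :=
              ENNReal.rpow_le_rpow (lintegral_mono fun Y => sum_blockMass_le_sliceSq hL hK hΦm Y)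
                (by norm_num)
          _ = 1 := by rw [hint, ENNReal.one_rpow]

/-- **MARG_h(η)** (crux · DECLARED RESIDUAL of gen 35 (v2) · TAG WEAKER than NUM_h(η)
(`horizonCellCountAffinity_of_horizonCountAffinity`) hence than LAB_h(η) · UNDECIDED-CELL · TRUE-type · NECESSARY
for flat-mode BEC (`occupation_flat_le_countAffinity` + `countAffinity_le_cellCountAffinity`) · leaf IDEA-NEEDED)
`GroundStateHorizonCellCountAffinity η`: at all sufficiently coarse horizon windows the nonnegative ground state has
ONE-CELL COUNT AFFINITY `≥ c`: for a `K^{-3/2}·Q(B)^{1/2}`-positive fraction of horizon cells `B`, the law of the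
occupation number `N_B` of `|Ψ₀|²` is Hellinger-close to its size-biased unit shift — UNIT-SCALE SMOOTHNESS of the
law of ONE integer-valued random variable (no parity / commensuration lock of a single cell's count), the most
local form of number non-rigidity.  STRICTLY weaker than NUM_h: in a pair-parity-locked model state (cells paired,
`N_B + N_{B*}` even, otherwise Poisson-like) every single-cell law is smooth (MARG holds, affinity `1 − O(K³/N)`)
while inserting one particle flips a pair parity (NUM fails, `countAffinity ≤ √2·K^{-3/2}`); fails in the
number-locked (Mott) model (`cellCountAffinity = K^{-3/2}`).  Outside the energy class for the same reason as
NUM_h (a one-cell parity lock costs area-order energy `≪` LHY precision).  Sufficient inputs in print shape: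
log-concavity (ULC) of `p_B` WITH a variance floor (`max_j p_B(j) ≤ (1 + Var N_B)^{-1/2}`-type bounds for discrete
log-concave laws) and `Var N_B ≤ C·E N_B`; none is known for `|Ψ₀|²` of interacting bosons.  Why it might fail:
only through unit-scale locking of a single horizon cell's occupation number in the true ground state.
[cite: GhoshPeres2017, DOI 10.1215/00127094-2017-0002 (rigidity–tolerance); LSSY2005, Thm 7.1 (GP-box BEC ⇒ MARG
there)] -/
@[conjecture] def GroundStateHorizonCellCountAffinity (η : ℝ≥0) : Prop :=
  ∀ v : ℝ → ℝ≥0∞, IsRepulsiveFiniteRange v → 0 < scatteringLength v →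
    ∃ M₀ : ℝ, 0 < M₀ ∧ ∀ M : ℝ, M₀ ≤ M → ∃ c : ℝ, 0 < c ∧ ∃ ρ₀ : ℝ, 0 < ρ₀ ∧ ∀ ρ : ℝ, 0 < ρ → ρ < ρ₀ →
      ∀ᶠ n : ℕ in atTop,
        (∃ Ψ₀ : Config (n + 1) → ℝ, (∀ X, 0 ≤ Ψ₀ X) ∧
          IsGroundState v (sideLength ρ (n + 1)) (fun X => (Ψ₀ X : ℂ))) →
        ∀ K : ℕ, 0 < K → InWindow (M * ρ ^ (-(η : ℝ))) ρ (sideLength ρ (n + 1)) K →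
          ENNReal.ofReal c ≤
            cellCountAffinity (sideLength ρ (n + 1)) K (groundState v (n + 1) (sideLength ρ (n + 1)))

/-- **CSUF_h(η)** (crux · TAG WEAKER-OR-EQUAL than NUM_h(η) (`horizonCellCountSufficiency_of_horizonCountAffinity`,
`s = c`) · UNDECIDED-JOINT · leaf conditional (natural sufficient condition: smoothness of the conditional law of
`m_B` given all cells but `B, B'` — two-cell transfer smoothness — on `P̄`-most count fields))
`GroundStateHorizonCellCountSufficiency η`: `countAffinity ≥ s · cellCountAffinity` at all sufficiently coarse
horizon windows: CELL-COUNT SUFFICIENCY — the joint count field carries no ARITHMETIC constraint beyond what single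
cells show, up to the factor `s` in Bhattacharyya terms.  Holds (vacuously, both sides `≍ K^{-3/2}`) in the Mott
model where MARG_h fails; fails in the pair-parity-locked model where MARG_h holds — so it is independent of MARG_h
and strictly weaker than NUM_h.  Why it might fail: a hidden joint lock (pair / sublattice parity of horizon
counts) in `|Ψ₀|²` with individually smooth cell counts.
[cite: LSSY2005, Thm 7.1 (flat-mode BEC ⇒ NUM ⇒ CSUF with `s = c`, by `cellCountAffinity_le_one`)] -/
@[conjecture] def GroundStateHorizonCellCountSufficiency (η : ℝ≥0) : Prop :=
  ∀ v : ℝ → ℝ≥0∞, IsRepulsiveFiniteRange v → 0 < scatteringLength v →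
    ∃ M₀ : ℝ, 0 < M₀ ∧ ∀ M : ℝ, M₀ ≤ M → ∃ s : ℝ, 0 < s ∧ ∃ ρ₀ : ℝ, 0 < ρ₀ ∧ ∀ ρ : ℝ, 0 < ρ → ρ < ρ₀ →
      ∀ᶠ n : ℕ in atTop,
        (∃ Ψ₀ : Config (n + 1) → ℝ, (∀ X, 0 ≤ Ψ₀ X) ∧
          IsGroundState v (sideLength ρ (n + 1)) (fun X => (Ψ₀ X : ℂ))) →
        ∀ K : ℕ, 0 < K → InWindow (M * ρ ^ (-(η : ℝ))) ρ (sideLength ρ (n + 1)) K →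
          ENNReal.ofReal s *
              cellCountAffinity (sideLength ρ (n + 1)) K (groundState v (n + 1) (sideLength ρ (n + 1))) ≤
            countAffinity (sideLength ρ (n + 1)) K (groundState v (n + 1) (sideLength ρ (n + 1)))

/-- **MARG_h ∧ CSUF_h ⟹ NUM_h** (take `M₀ = max`, constant `s·c`). [folklore] -/
theorem horizonCountAffinity_of_cell (η : ℝ≥0) (hmarg : GroundStateHorizonCellCountAffinity η)
    (hcsuf : GroundStateHorizonCellCountSufficiency η) : GroundStateHorizonCountAffinity η := by
  intro v hv ha
  obtain ⟨M₁, hM₁, hmarg'⟩ := hmarg v hv ha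
  obtain ⟨M₂, hM₂, hcsuf'⟩ := hcsuf v hv ha
  refine ⟨max M₁ M₂, lt_max_of_lt_left hM₁, fun M hM => ?_⟩
  obtain ⟨c, hc, ρ₁, hρ₁, hc'⟩ := hmarg' M ((le_max_left _ _).trans hM)
  obtain ⟨s, hs, ρ₂, hρ₂, hs'⟩ := hcsuf' M ((le_max_right _ _).trans hM)
  refine ⟨s * c, mul_pos hs hc, min ρ₁ ρ₂, lt_min hρ₁ hρ₂, fun ρ hρ hρlt => ?_⟩
  have h1 : ρ < ρ₁ := hρlt.trans_le (min_le_left _ _)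
  have h2 : ρ < ρ₂ := hρlt.trans_le (min_le_right _ _)
  filter_upwards [hc' ρ hρ h1, hs' ρ hρ h2] with n hcn hsn hex K hK hKw
  calc ENNReal.ofReal (s * c) = ENNReal.ofReal s * ENNReal.ofReal c := ENNReal.ofReal_mul hs.le
    _ ≤ ENNReal.ofReal s *
          cellCountAffinity (sideLength ρ (n + 1)) K (groundState v (n + 1) (sideLength ρ (n + 1))) :=
        mul_le_mul' le_rfl (hcn hex K hK hKw)
    _ ≤ countAffinity (sideLength ρ (n + 1)) K (groundState v (n + 1) (sideLength ρ (n + 1))) :=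
        hsn hex K hK hKw

/-- **NUM_h ⟹ MARG_h** — the v2 residual is WEAKER than NUM_h (`countAffinity_le_cellCountAffinity`). [folklore] -/
theorem horizonCellCountAffinity_of_horizonCountAffinity (η : ℝ≥0) (hnum : GroundStateHorizonCountAffinity η) :
    GroundStateHorizonCellCountAffinity η := by
  intro v hv ha
  obtain ⟨M₀, hM₀, h⟩ := hnum v hv ha
  refine ⟨M₀, hM₀, fun M hM => ?_⟩
  obtain ⟨c, hc, ρ₀, hρ₀, h'⟩ := h M hM
  refine ⟨c, hc, ρ₀, hρ₀, fun ρ hρ hρlt => ?_⟩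
  filter_upwards [h' ρ hρ hρlt] with n hn hex K hK hKw
  exact (hn hex K hK hKw).trans (countAffinity_le_cellCountAffinity _ K _)

/-- **NUM_h ⟹ CSUF_h** with `s = c` (`cellCountAffinity ≤ 1` for the normalised ground state). [folklore] -/
theorem horizonCellCountSufficiency_of_horizonCountAffinity (η : ℝ≥0)
    (hnum : GroundStateHorizonCountAffinity η) : GroundStateHorizonCellCountSufficiency η := by
  intro v hv ha
  obtain ⟨M₀, hM₀, h⟩ := hnum v hv ha
  refine ⟨M₀, hM₀, fun M hM => ?_⟩
  obtain ⟨c, hc, ρ₀, hρ₀, h'⟩ := h M hM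
  refine ⟨c, hc, ρ₀, hρ₀, fun ρ hρ hρlt => ?_⟩
  filter_upwards [h' ρ hρ hρlt] with n hn hex K hK hKw
  have hA : 0 < M * ρ ^ (-(η : ℝ)) := mul_pos (hM₀.trans_le hM) (Real.rpow_pos_of_pos hρ _)
  set L := sideLength ρ (n + 1) with hLdef
  have hL : 0 < L := sideLength_pos_of_inWindow hA hρ hK hKw
  set Φ := groundState v (n + 1) L with hΦdef
  have hΦm : Measurable Φ := measurable_groundState v (n + 1) L
  have hΦ1 : ∫⁻ Y : Config n, ∫⁻ x, ENNReal.ofReal (Φ (Matrix.vecCons x Y)) ^ 2 = 1 := by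
    rw [← lintegral_eq_lintegral_lintegral_vecCons (hΦm.ennreal_ofReal.pow_const 2)]
    exact lintegral_groundState_sq hex
  calc ENNReal.ofReal c * cellCountAffinity L K Φ ≤ ENNReal.ofReal c * 1 :=
        mul_le_mul' le_rfl (cellCountAffinity_le_one hL hK hΦm hΦ1)
    _ = ENNReal.ofReal c := mul_one _
    _ ≤ countAffinity L K Φ := hn hex K hK hKw

/-- **EXACTNESS OF THE SECOND CARVING**: NUM_h(η) ⟺ MARG_h(η) ∧ CSUF_h(η). [folklore] -/
theorem horizonCountAffinity_iff_cell (η : ℝ≥0) :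
    GroundStateHorizonCountAffinity η ↔
      GroundStateHorizonCellCountAffinity η ∧ GroundStateHorizonCellCountSufficiency η :=
  ⟨fun h => ⟨horizonCellCountAffinity_of_horizonCountAffinity η h,
    horizonCellCountSufficiency_of_horizonCountAffinity η h⟩,
    fun h => horizonCountAffinity_of_cell η h.1 h.2⟩

/-- LAB_h(η) ⟺ MARG_h(η) ∧ CSUF_h(η) ∧ SUF_h(η): the two carvings composed. [folklore] -/
theorem horizonLabelAffinity_iff_cell (η : ℝ≥0) :
    GroundStateHorizonLabelAffinity η ↔
      GroundStateHorizonCellCountAffinity η ∧ GroundStateHorizonCellCountSufficiency η ∧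
        GroundStateHorizonCountSufficiency η := by
  rw [horizonLabelAffinity_iff_count, horizonCountAffinity_iff_cell, and_assoc]

/-- **DECIDING KERNEL OF GEN 35 (v2)** (0 sorry; hypotheses = the pieces only):
UGS → LOC_h(η) → MARG_h(η) → CSUF_h(η) → SUF_h(η) → `BoseEinsteinCondensation`. [folklore] -/
theorem bec_of_cellCountPieces₀ (η : ℝ≥0) (hU : BoxGroundStateUniqueness)
    (hloc : GroundStateHorizonCondensation η) (hmarg : GroundStateHorizonCellCountAffinity η)
    (hcsuf : GroundStateHorizonCellCountSufficiency η) (hsuf : GroundStateHorizonCountSufficiency η) :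
    _root_.BoseEinsteinCondensation :=
  bec_of_countPieces₀ η hU hloc (horizonCountAffinity_of_cell η hmarg hcsuf) hsuf

/-- The v2 node assembled down to the energy-class leaves (0 sorry):
UGS → LOC → TSD(η) → MARG_h(η) → CSUF_h(η) → SUF_h(η) → `BoseEinsteinCondensation`. [folklore] -/
theorem bec_of_twoScaleCellCount₀ (η : ℝ≥0) (hU : BoxGroundStateUniqueness)
    (hloc : GroundStateBlockCondensation) (htsd : GroundStateTwoScaleDepletion η)
    (hmarg : GroundStateHorizonCellCountAffinity η) (hcsuf : GroundStateHorizonCellCountSufficiency η)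
    (hsuf : GroundStateHorizonCountSufficiency η) : _root_.BoseEinsteinCondensation :=
  bec_of_cellCountPieces₀ η hU (horizonCondensation_of_loc_twoScale η hloc htsd) hmarg hcsuf hsuf


end Summit.AtomisticToContinuum.BoseEinsteinCondensation.Theorems.BoxCountShadow
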